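import Summits.BirchSwinnertonDyer.BirchSwinnertonDyer.Theorems.ThetaPartnerAtTwoSignedKatoUpToAtTwoCuspFactorCharValue
import Summits.BirchSwinnertonDyer.BirchSwinnertonDyer.Theorems.ThetaPartnerAtTwoSignedKatoUpToAtTwoCuspFactorCharacter
import Summits.BirchSwinnertonDyer.BirchSwinnertonDyer.Theorems.ThetaPartnerAtTwoSignedKatoUpToAtTwoCuspFactorKatoGuards
import HarnessLib

/-!
# Route `ThetaPartnerAtTwo` (TP2), crux K3 `SignedKatoDivisibilityUpToAtTwo` (stmt-BirchSwinnertonDyer-20308 / K3P′ 25631), line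
# `colemanrat` v12/v13 — the EVALUATION CLAUSE of brick B1: the character value of the four-term cusp element is `D · R⁻(χ; c, d, a, 2^e, d′)`

Width seat `bsd-wall-tp2-p2x-w2` g6 (cell `bsd-wall`). HONEST FRAMING: theorems only (no definition, no named fact, no instance, no
`sorry`); closes no item; K3 / K3P′ are NOT settled and BSD is NOT proved by any of this.

## What (lead memo `G7-ASSEMBLY-v1.md` §0.5 / B1: «evaluation clause `∀ n χ even 2-power-order, μ̃(χ) = D·R⁻(χ;c,d,a,2^e,d′)`»)

For the data of `CuspEval.exists_cuspElement_not_mem_of_rohrlich` (classes `a, cb, db ∈ (ℤ/2^e)^×`, naturals `c, d` with `2`-adic units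
`u_c, u_d`, `↑u_c = c`, `↑u_d = d`, `↑cb = c` (`db` = the class of `d`, entering only through `d′ = (db⁻¹).val`), integer table `t(b) = D·[(a·b).val/2^e]⁻_f`) and every EVEN Dirichlet character
`χ` modulo `2^n` of `2`-power order with values in `ℂ₂`, the element
`μ̃ = C(c²d²t(1)) − C(cd²t(cb))·(1+T)^{ℓ(u_c)} − C(c²d t(db⁻¹))·(1+T)^{ℓ(u_d)} + C(cd t(cb·db⁻¹))·(1+T)^{ℓ(u_c)}(1+T)^{ℓ(u_d)}` evaluated at
`T = χ(5) − 1` is `D·(c²d²[a/A]⁻ − cd²·χ(c)·[ac/A]⁻ − c²d·χ(d)·[ad′/A]⁻ + cd·χ(c)χ(d)·[acd′/A]⁻)` with `A = 2^e`, `a` read as the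
integer `a.val`, `d′ = (db⁻¹).val` (`d·d′ ≡ 1 (A)`), i.e. `D` times Kato's cusp factor `cuspFactor f true χ c d a A d′` read in `ℂ₂` with
`χ̄_Kato = χ` (Thm. 6.6 (1), parity cross-over: even characters see MINUS symbols) — `hasSum_cuspElement_character`. Ingredients:
`CuspEval.tsum_coeff_cuspElement` (evaluation is a ring map on `Λ`), `CuspEval.hasSum_binomialSeries_ell_character` (`U_c(χ) = χ(c)`),
`CuspEval.ratMinusSymbol_kato_cusps` (the cusps as classes).

References: [Kato2004Asterisque] K. Kato, Astérisque 295 (2004), Thm. 6.6 (1) (p. 163), Lemma 13.10 (1) (p. 230), §13.12; [MazurTateTeitelbaum1986Invent] §I.13.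
-/

set_option autoImplicit false
-- the Theorems namespace of this sub repeats the summit name by design (D-0017 nested layout)
set_option linter.dupNamespace false

noncomputable section

open scoped BigOperators

open Literature.NumberTheory.EllipticCurves Literature.NumberTheory.EllipticCurves.CyclotomicZp

namespace Summit.BirchSwinnertonDyer.BirchSwinnertonDyer.Theorems.SignedKatoOffTwo.CuspEval

/-- **Evaluation clause of the cusp element (brick B1).** See the module docstring: at `T = χ(5) − 1` for an even `2`-power-order
`χ` modulo `2^n` (values in `ℂ₂`), the four-term cusp element of `exists_cuspElement_not_mem_of_rohrlich` (η = 1) evaluates to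
`D·(c²d²[a/A]⁻ − cd²χ(c)[ac/A]⁻ − c²dχ(d)[ad′/A]⁻ + cdχ(c)χ(d)[acd′/A]⁻)`, `A = 2^e`, `d′ = (db⁻¹).val` — `D` times Kato's `R⁻(χ)`.
[cite: Kato2004Asterisque, Thm. 6.6 (1) (p. 163), Lemma 13.10 (1) (p. 230)] [cite: MazurTateTeitelbaum1986Invent, §I.13] -/
theorem hasSum_cuspElement_character {N : ℕ} [NeZero N] (f : CuspForm (CongruenceSubgroup.Gamma0 N) 2)
    {e : ℕ} [NeZero (2 ^ e)] (a cb db : (ZMod (2 ^ e))ˣ) (c d : ℕ) (uc ud : ℤ_[2]ˣ)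
    (huc : (uc : ℤ_[2]) = c) (hud : (ud : ℤ_[2]) = d) (hcb : (cb : ZMod (2 ^ e)) = c)
    (D : ℕ) (t : (ZMod (2 ^ e))ˣ → ℤ)
    (ht : ∀ b : (ZMod (2 ^ e))ˣ, (t b : ℚ) = D * ratMinusSymbol f ((((a * b : (ZMod (2 ^ e))ˣ) : ZMod (2 ^ e)).val : ℚ) / 2 ^ e))
    {n : ℕ} (χ : DirichletCharacter ℂ_[2] (2 ^ n)) (hχ : χ.Even) (hord : ∃ j : ℕ, orderOf χ = 2 ^ j) :
    HasSum (fun k ↦ ((algebraMap ℚ_[2] ℂ_[2]).comp (algebraMap ℤ_[2] ℚ_[2]))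
        (PowerSeries.coeff k
          (PowerSeries.C ((c ^ 2 * d ^ 2 * t 1 : ℤ) : ℤ_[2])
            - PowerSeries.C ((c * d ^ 2 * t cb : ℤ) : ℤ_[2]) * PowerSeries.binomialSeries ℤ_[2] (ell 2 uc)
            - PowerSeries.C ((c ^ 2 * d * t db⁻¹ : ℤ) : ℤ_[2]) * PowerSeries.binomialSeries ℤ_[2] (ell 2 ud)
            + PowerSeries.C ((c * d * t (cb * db⁻¹) : ℤ) : ℤ_[2]) * PowerSeries.binomialSeries ℤ_[2] (ell 2 uc) *
                PowerSeries.binomialSeries ℤ_[2] (ell 2 ud))) *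
        (χ (cyclotomicGenerator 2 : ZMod (2 ^ n)) - 1) ^ k)
      ((D : ℂ_[2]) *
        ((c : ℂ_[2]) ^ 2 * (d : ℂ_[2]) ^ 2 *
            ((ratMinusSymbol f ((((a : ZMod (2 ^ e)).val : ℤ) : ℚ) / (2 ^ e : ℕ)) : ℚ) : ℂ_[2])
          - (c : ℂ_[2]) * (d : ℂ_[2]) ^ 2 * χ (c : ZMod (2 ^ n)) *
            ((ratMinusSymbol f ((((a : ZMod (2 ^ e)).val : ℤ) * (c : ℤ) : ℚ) / (2 ^ e : ℕ)) : ℚ) : ℂ_[2])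
          - (c : ℂ_[2]) ^ 2 * (d : ℂ_[2]) * χ (d : ZMod (2 ^ n)) *
            ((ratMinusSymbol f ((((a : ZMod (2 ^ e)).val : ℤ) * (((db⁻¹ : (ZMod (2 ^ e))ˣ) : ZMod (2 ^ e)).val : ℤ) : ℚ) /
              (2 ^ e : ℕ)) : ℚ) : ℂ_[2])
          + (c : ℂ_[2]) * (d : ℂ_[2]) * (χ (c : ZMod (2 ^ n)) * χ (d : ZMod (2 ^ n))) *
            ((ratMinusSymbol f ((((a : ZMod (2 ^ e)).val : ℤ) * (c : ℤ) *
              (((db⁻¹ : (ZMod (2 ^ e))ˣ) : ZMod (2 ^ e)).val : ℤ) : ℚ) / (2 ^ e : ℕ)) : ℚ) : ℂ_[2]))) := by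
  set ι := (algebraMap ℚ_[2] ℂ_[2]).comp (algebraMap ℤ_[2] ℚ_[2]) with hι
  set z : ℂ_[2] := χ (cyclotomicGenerator 2 : ZMod (2 ^ n)) - 1 with hz_def
  have hz : ‖z‖ < 1 := norm_apply_cyclotomicGenerator_sub_one_lt χ hord
  -- the series is summable; its sum is computed by `tsum_coeff_cuspElement`
  set M : PowerSeries ℤ_[2] :=
    PowerSeries.C ((c ^ 2 * d ^ 2 * t 1 : ℤ) : ℤ_[2])
      - PowerSeries.C ((c * d ^ 2 * t cb : ℤ) : ℤ_[2]) * PowerSeries.binomialSeries ℤ_[2] (ell 2 uc)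
      - PowerSeries.C ((c ^ 2 * d * t db⁻¹ : ℤ) : ℤ_[2]) * PowerSeries.binomialSeries ℤ_[2] (ell 2 ud)
      + PowerSeries.C ((c * d * t (cb * db⁻¹) : ℤ) : ℤ_[2]) * PowerSeries.binomialSeries ℤ_[2] (ell 2 uc) *
          PowerSeries.binomialSeries ℤ_[2] (ell 2 ud) with hM
  have hsum : Summable fun k ↦ ι (PowerSeries.coeff k M) * z ^ k :=
    summable_map_coeff_mul_pow ι (norm_algebraMap_coeff_le_one M) hz
  -- the two avatars evaluate to `χ(c)`, `χ(d)`
  have hUc := (hasSum_binomialSeries_ell_character χ hχ hord uc huc).tsum_eq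
  have hUd := (hasSum_binomialSeries_ell_character χ hχ hord ud hud).tsum_eq
  rw [← hz_def] at hUc hUd
  -- the four symbols as classes
  obtain ⟨h1, h2, h3, h4⟩ := ratMinusSymbol_kato_cusps f a cb db (c : ℤ) (by rw [Int.cast_natCast, hcb])
  have ht1 : ((t 1 : ℤ) : ℂ_[2]) = (D : ℂ_[2]) * ((ratMinusSymbol f ((((a : ZMod (2 ^ e)).val : ℤ) : ℚ) / (2 ^ e : ℕ)) : ℚ) : ℂ_[2]) := by
    have h := congrArg (fun q : ℚ ↦ (q : ℂ_[2])) (ht 1)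
    simp only [Rat.cast_intCast, Rat.cast_mul, Rat.cast_natCast] at h
    rw [h, h1]; push_cast; rfl
  have ht2 : ((t cb : ℤ) : ℂ_[2]) =
      (D : ℂ_[2]) * ((ratMinusSymbol f ((((a : ZMod (2 ^ e)).val : ℤ) * (c : ℤ) : ℚ) / (2 ^ e : ℕ)) : ℚ) : ℂ_[2]) := by
    have h := congrArg (fun q : ℚ ↦ (q : ℂ_[2])) (ht cb)
    simp only [Rat.cast_intCast, Rat.cast_mul, Rat.cast_natCast] at h
    rw [h, h2]; push_cast; rfl
  have ht3 : ((t db⁻¹ : ℤ) : ℂ_[2]) = (D : ℂ_[2]) *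
      ((ratMinusSymbol f ((((a : ZMod (2 ^ e)).val : ℤ) * (((db⁻¹ : (ZMod (2 ^ e))ˣ) : ZMod (2 ^ e)).val : ℤ) : ℚ) /
        (2 ^ e : ℕ)) : ℚ) : ℂ_[2]) := by
    have h := congrArg (fun q : ℚ ↦ (q : ℂ_[2])) (ht db⁻¹)
    simp only [Rat.cast_intCast, Rat.cast_mul, Rat.cast_natCast] at h
    rw [h, h3]; push_cast; rfl
  have ht4 : ((t (cb * db⁻¹) : ℤ) : ℂ_[2]) = (D : ℂ_[2]) *
      ((ratMinusSymbol f ((((a : ZMod (2 ^ e)).val : ℤ) * (c : ℤ) * (((db⁻¹ : (ZMod (2 ^ e))ˣ) : ZMod (2 ^ e)).val : ℤ) : ℚ) /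
        (2 ^ e : ℕ)) : ℚ) : ℂ_[2]) := by
    have h := congrArg (fun q : ℚ ↦ (q : ℂ_[2])) (ht (cb * db⁻¹))
    simp only [Rat.cast_intCast, Rat.cast_mul, Rat.cast_natCast] at h
    rw [h, ← mul_assoc, h4]; push_cast; rfl
  -- conclude
  convert hsum.hasSum using 1
  symm
  rw [hM, tsum_coeff_cuspElement hz, hUc, hUd, map_intCast, map_intCast, map_intCast, map_intCast]
  push_cast
  rw [ht1, ht2, ht3, ht4]
  push_cast
  ring

end Summit.BirchSwinnertonDyer.BirchSwinnertonDyer.Theorems.SignedKatoOffTwo.CuspEval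

end
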